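import Literature.NumberTheory.EllipticCurves.RationalTwoTorsionConductorAtThree
import Literature.NumberTheory.DiophantineGeometry.ConductorExponentLeTwoOfTwoTorsionProofs
import HarnessLib

/-!
# Discharge of `Silverman1994_conductorExponent_three_le_two_of_rationalTwoTorsion` (Ogg–Saito at `3`)

`Proofs` file (theorems only) for the named fact of
`Literature.NumberTheory.EllipticCurves.RationalTwoTorsionConductorAtThree`:

  `∀ (W : WeierstrassCurve ℚ) [W.IsElliptic] (x : ℚ), HasRationalTwoTorsionX W x →
     ∀ v : HeightOneSpectrum ℤ, natGenerator v = 3 → W.conductorExponent v ≤ 2`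

— for an elliptic curve over `ℚ` (ANY Weierstrass model, not necessarily minimal) with a rational point of order
`2`, the conductor exponent at `3` is at most `2` (Silverman, ATAEC IV §10, Thm 10.2 with §11 for `p = 3`: the wild
part `δ₃` is read on `E[2]`, and `ℚ₃(E[2])/ℚ₃` has degree `≤ 2`, hence is tame).

The proof is the kernel theorem
`WeierstrassCurve.conductorExponent_le_two_of_natGenerator_ne_two_of_twoTorsion`
(`Literature/NumberTheory/DiophantineGeometry/ConductorExponentLeTwoOfTwoTorsionProofs.lean`): with `f_v` DEFINED by
Ogg's formula, a root of the `2`-division cubic `4x³ + b₂x² + 2b₄x + b₆` (here `x(P)` for the rational `2`-torsion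
point `P`, `WeierstrassCurve.twoTorsionRoot_of_equation`) excludes the exits II, IV, IV*, II* of Tate's algorithm at
every place `v ∤ 2`, and the remaining types have `ord_v Δ_min ≤ m_v + 1`
(`Literature/NumberTheory/DiophantineGeometry/TateAlgorithmTwoTorsionExitsProofs.lean`). In fact `f_v ≤ 2` holds at
EVERY odd place, not only at `3` (`conductorExponent_le_two_of_natGenerator_ne_two_of_hasRationalTwoTorsionX` below).

References: J. H. Silverman, *Advanced Topics in the Arithmetic of Elliptic Curves*, GTM 151 (1994), IV.9.4,
Table 4.1, IV.10.2, IV.11 [Silverman1994]; A. Ogg, Amer. J. Math. 89 (1967) [Ogg1967].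
-/

noncomputable section

open scoped Classical

open WeierstrassCurve IsDedekindDomain Rat.HeightOneSpectrum
  Literature.NumberTheory.EllipticCurves.Greenberg1999

namespace Literature.NumberTheory.EllipticCurves

/-- `f_v ≤ 2` at every place `v` of `ℚ` over an ODD prime for an elliptic curve with a rational point of order `2`
(`HasRationalTwoTorsionX W x`: an affine point `(x, y)` with `2y + a₁x + a₃ = 0`). [cite: Silverman1994, IV.10.2] -/
theorem conductorExponent_le_two_of_natGenerator_ne_two_of_hasRationalTwoTorsionX (W : WeierstrassCurve ℚ)
    [W.IsElliptic] {x : ℚ} (hx : HasRationalTwoTorsionX W x) (v : HeightOneSpectrum ℤ)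
    (hv : natGenerator v ≠ 2) : W.conductorExponent v ≤ 2 := by
  obtain ⟨y, hE, h2⟩ := hx
  exact W.conductorExponent_le_two_of_natGenerator_ne_two_of_twoTorsion v hv (W.twoTorsionRoot_of_equation hE h2)

/-- **Discharge (D-0014) of the named fact `Silverman1994_conductorExponent_three_le_two_of_rationalTwoTorsion`:**
for an elliptic curve over `ℚ` with a rational point of order `2`, `f₃ ≤ 2` (the case `natGenerator v = 3 ≠ 2` of
`conductorExponent_le_two_of_natGenerator_ne_two_of_hasRationalTwoTorsionX`). [cite: Silverman1994, IV.10.2] -/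
theorem Silverman1994_conductorExponent_three_le_two_of_rationalTwoTorsion_holds :
    Silverman1994_conductorExponent_three_le_two_of_rationalTwoTorsion := by
  intro W _ x hx v hv
  exact conductorExponent_le_two_of_natGenerator_ne_two_of_hasRationalTwoTorsionX W hx v (by omega)

/-- The consumer shape of the BSD line `star` (`hOgg3`), now UNCONDITIONAL: `ord₃ N_V ≤ 2` for every elliptic `V/ℚ`
with a rational point of order `2`. [cite: Silverman1994, IV.10.2] -/
theorem factorization_conductorNorm_three_le_two_of_hasRationalTwoTorsionX :
    ∀ (V : WeierstrassCurve ℚ) [V.IsElliptic] (z : ℚ), HasRationalTwoTorsionX V z →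
      (V.conductorNorm ℤ).factorization 3 ≤ 2 :=
  Silverman1994_conductorExponent_three_le_two_of_rationalTwoTorsion.factorization_three_le_two
    Silverman1994_conductorExponent_three_le_two_of_rationalTwoTorsion_holds

end Literature.NumberTheory.EllipticCurves

end
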